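import Literature.NumberTheory.EllipticCurves.ZpExtensionLayersLocalSymbolProofs
import Literature.NumberTheory.EllipticCurves.Kato2004.IwasawaH1ReductionInfty
import Literature.NumberTheory.NumberFields.IdelicArtinMapConjugation
import Literature.NumberTheory.GaloisRepresentations.LocalArtinMapPinned
import Literature.NumberTheory.EllipticCurves.GreenbergSelmer
import HarnessLib

/-!
# The `ℤ_p`-valued idelic character of a `ℤ_p`-extension (proofs only)

Topic `NumberTheory/EllipticCurves` (Iwasawa theory of `ℤ_p`-extensions); namespace
`Literature.NumberTheory.EllipticCurves.ZpExtension`.  THEOREMS ONLY (no definition, no named fact,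
no instance; D-0026).  First half of the discharge of the named fact
`ZpExtension.decomp_not_le_kerSubgroup_of_isAnticyclotomic` (Brink 2007, Thm. 2: a prime `v ∤ p`
of an imaginary quadratic field over a rational prime split in `K` is finitely decomposed in the
anticyclotomic `ℤ_p`-extension); the second half is
`AnticyclotomicPrimeDecompositionSplitProofs.lean`.

For a number field `K : Type` and a continuous character `χ : Γ_K → ℤ_p` (e.g. a `ℤ_p`-extension
`κ : Γ_K ↠ ℤ_p`, the tree's `ZpExtension K p`), `χ` kills the closed commutator subgroup, so
`χ = χ^ab ∘ (Γ_K → Γ_K^ab)`; its **idelic character** is `Λ = χ^ab ∘ [·, K] : 𝕀_K → ℤ_p`, where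
`[·, K] = ideleArtinMap K` is Shimura's idelic Artin map of the tree (`…/NumberFields/IdelicArtinMap`,
assembled there from the tree's PROVED global class field theory).  No definition is introduced:
the lemmas take `Λ` together with its defining property
`hΛ : ∀ a γ, [a, K] = γ|_{K^ab} → Λ a = χ γ`, and `exists_idelicCharacter` provides such a `Λ`.

* §1 `exists_idelicCharacter`; `Λ(Kˣ) = 1` (Artin reciprocity, Tate VII 4.2 (ii)); `Λ(K_∞ˣ) = 1`
  for `K` totally complex (`ideleArtinMap_infiniteIdeles`); **transport** `Λ(ḡ • a) = χ(θ_g γ)` for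
  `g ∈ Γ_ℚ` (`K/ℚ` Galois, `θ_g` = conjugation by a lift of `g`, Neukirch IV (5.8) / Tate VII 11.5
  in the limit: the tree's `absGaloisConjAb_ideleArtinMap`), hence `Λ(ḡ • a) = (Λ a)⁻¹` when `g`
  inverts `χ` (anticyclotomic sign, Brink §II Prop. 1) and `Λ(ḡ • a) = Λ a` when `g` fixes `χ`.
* §2 for `χ = κ` a `ℤ_p`-extension, values through the layers `K_n` (`ψ_{K_n|K}(a) = [a, K]|_{K_n}`):
  `Λ(⟨𝒪_wˣ⟩) = 1` at `w ∤ p` (Washington Prop. 13.2 + Tate 4.2 (iii)); the **local symbol**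
  `Λ(⟨a_v w⟩_v) = κ(res_v w)⁻¹` (Neukirch VI (5.6), the tree's `ArtinLocalGlobal`); so **if `v`
  splits completely in `K_∞` (`D_v ≤ ker κ`) then `Λ(⟨K_vˣ⟩) = 1`**; the product formula
  `∏_{w ∈ S} Λ(⟨k⟩_w) = 1` for `k ∈ Kˣ` a unit outside `S ⊇ {w ∣ p}` (Neukirch VII (6.13)).
* §3 **non-vanishing on the local units above `p`**: if `Λ` killed `⟨𝒪_wˣ⟩` for every `w ∣ p`, it
  would kill every local idele (finiteness of the class group: `𝔭_w^h = (β)`, and `ℤ_p` is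
  torsion-free) and hence all of `𝕀_K` (an idele is `(a)_∞ · ∏_{w ∈ T} ⟨a_w⟩ ·` a unit idele), so
  `κ = 1` by the surjectivity of `[·, K]` — absurd (Lang, *Cyclotomic Fields*, Ch. 5 §5: `K_∞/K` is a
  quotient of `Gal(M/K) ∼ U_p/Ē`).

## References

* J. Neukirch, *Algebraic Number Theory*, Springer 1999, Ch. IV §5 (5.8), Ch. VI §5 (5.6), §6
  (6.1), Ch. VII §6 (6.13). [NeukirchANT1999]
* J. Tate, *Global class field theory*, Ch. VII of Cassels–Fröhlich (1967), §4.2, §6 Prop. 6.2,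
  Thm. 11.5. [CasselsFrohlichANT1967]
* S. Lang, *Cyclotomic Fields I and II*, GTM 121 (1990), Ch. 5 §5. [Lang1990]
* L. C. Washington, *Introduction to Cyclotomic Fields* (1997), §13.1, Prop. 13.2. [Washington1997]
* D. Brink, *Prime decomposition in the anti-cyclotomic extension*, Math. Comp. 76 (2007), §II
  Prop. 1. [Brink2007]

## Tree search

`lean search 'idelicCharacter|ideleArtinMap.*ZpExtension|exists_pow_asIdeal_eq_span'`: no prior hits
(the private `exists_pow_eq_span` of `…/Liu2021/Prop46NonemptyOfCasselmanUniformizers` and of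
`AnticyclotomicLocalNormResidueSymbolProofs` are re-proved here as public lemmas).
-/

noncomputable section

open Field NumberField IsDedekindDomain

namespace Literature.NumberTheory.EllipticCurves.ZpExtension

open Literature.NumberTheory.GaloisRepresentations Literature.NumberTheory.NumberFields

/-! ### §1. The idelic character of a continuous `ℤ_p`-valued character of `Γ_K` -/

section Character

variable {K : Type} [Field K] [NumberField K] {p : ℕ} [Fact p.Prime]

/-- **The idelic avatar `Λ = χ^ab ∘ [·, K]` of a continuous character `χ : Γ_K → ℤ_p`.**  A continuous
`ℤ_p`-valued character kills the closed commutator subgroup of `Γ_K`, hence factors through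
`Γ_K^ab`; composed with Shimura's `[·, K] : 𝕀_K → Γ_K^ab` (`ideleArtinMap`) it gives a continuous
character `Λ` of the idele group with `Λ a = χ γ` whenever `[a, K] = γ|_{K^ab}`.
[cite: NeukirchANT1999, Ch. VI §6 Thm. (6.1)] -/
theorem exists_idelicCharacter (χ : absoluteGaloisGroup K →ₜ* Multiplicative ℤ_[p]) :
    ∃ Λ : ideleGroup K →ₜ* Multiplicative ℤ_[p],
      ∀ (a : ideleGroup K) (γ : absoluteGaloisGroup K),
        absGaloisAbProj K γ = ideleArtinMap K a → Λ a = χ γ := by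
  -- `χ` kills the closed commutator subgroup
  have hle : (commutator (absoluteGaloisGroup K)).topologicalClosure ≤ χ.toMonoidHom.ker := by
    refine Subgroup.topologicalClosure_minimal _ (Abelianization.commutator_subset_ker χ.toMonoidHom) ?_
    change IsClosed (χ ⁻¹' {1})
    exact (isClosed_singleton (x := (1 : Multiplicative ℤ_[p]))).preimage (map_continuous χ)
  set χab : absoluteGaloisGroupAbelianization K →* Multiplicative ℤ_[p] :=
    QuotientGroup.lift _ χ.toMonoidHom hle with hχab
  have hχabc : Continuous χab := by
    refine (QuotientGroup.isQuotientMap_mk _).continuous_iff.mpr ?_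
    exact map_continuous χ
  refine ⟨⟨χab.comp (ideleArtinMap K), hχabc.comp (continuous_ideleArtinMap K)⟩, fun a γ h => ?_⟩
  change χab (ideleArtinMap K a) = χ γ
  rw [← h]
  rfl

variable {χ : absoluteGaloisGroup K →ₜ* Multiplicative ℤ_[p]} {Λ : ideleGroup K →ₜ* Multiplicative ℤ_[p]}
  (hΛ : ∀ (a : ideleGroup K) (γ : absoluteGaloisGroup K),
    absGaloisAbProj K γ = ideleArtinMap K a → Λ a = χ γ)
include hΛ

/-- Every value of `Λ` is a value of `χ` at a representative of `[a, K]` (`[·, K]` takes values in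
`Γ_K^ab = Gal(K^ab/K)`, Tate VII 5.4). [cite: CasselsFrohlichANT1967, Ch. VII 5.4 (PDF p. 213)] -/
theorem idelicCharacter_exists_eq (a : ideleGroup K) :
    ∃ γ : absoluteGaloisGroup K, absGaloisAbProj K γ = ideleArtinMap K a ∧ Λ a = χ γ := by
  obtain ⟨γ, hγ⟩ := QuotientGroup.mk_surjective (ideleArtinMap K a)
  exact ⟨γ, hγ, hΛ a γ hγ⟩

/-- **`Λ(Kˣ) = 1`** (Artin reciprocity `[Kˣ, K] = 1`). [cite: CasselsFrohlichANT1967, Ch. VII §4.2 Corollary (ii)] -/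
theorem idelicCharacter_eq_one_of_mem_principalIdeles {a : ideleGroup K} (ha : a ∈ principalIdeles K) :
    Λ a = 1 := by
  rw [hΛ a 1 (by rw [map_one, ideleArtinMap_eq_one_of_mem_principalIdeles ha]), map_one]

/-- **`Λ(K_∞ˣ) = 1` for `K` totally complex** (`[·, K]` kills the connected group `∏_w ℂˣ`).
[cite: Shimura1998, §18.3, p. 122] -/
theorem idelicCharacter_infiniteIdeles [IsTotallyComplex K] (y : (InfiniteAdeleRing K)ˣ) :
    Λ (infiniteIdeles K y) = 1 := by
  rw [hΛ _ 1 (by rw [map_one, ideleArtinMap_infiniteIdeles y]), map_one]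

/-- **Transport of structure** (Neukirch IV (5.8) / Tate VII 11.5 on `Γ_K^ab`): for `g ∈ Γ_ℚ` with
image `ḡ ∈ Gal(K/ℚ)` acting on the ideles, `Λ(ḡ • a) = χ(θ_g γ)` for any representative `γ` of
`[a, K]`, where `θ_g σ = ρ_g σ ρ_g⁻¹` is the conjugation of `Γ_K` induced by `g`
(`absGaloisConj`, with `res(θ_g σ) = g · res σ · g⁻¹`). [cite: NeukirchANT1999, Ch. IV §5 Prop. (5.8)] -/
theorem idelicCharacter_smul [IsGalois ℚ K] (g : absoluteGaloisGroup ℚ) {a : ideleGroup K}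
    {γ : absoluteGaloisGroup K} (hγ : absGaloisAbProj K γ = ideleArtinMap K a) :
    Λ (absGaloisQuot ℚ K g • a) = χ (absGaloisConj (smul_absEmbedding_eq_absGaloisQuot ℚ K g) γ) := by
  refine hΛ _ _ ?_
  rw [← absGaloisConjAb_ideleArtinMap g a, ← hγ, absGaloisConjAb_absGaloisAbProj]

/-- **Anticyclotomic sign**: if `χ` is inverted by conjugation by `g ∈ Γ_ℚ` (as is an anticyclotomic
`ℤ_p`-extension for `g ∉ res(Γ_K)`), then `Λ(ḡ • a) = (Λ a)⁻¹`. [cite: Brink2007, §II Prop. 1 (p. 2130)] -/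
theorem idelicCharacter_smul_eq_inv [IsGalois ℚ K] (g : absoluteGaloisGroup ℚ)
    (hg : ∀ σ τ : absoluteGaloisGroup K,
      absGaloisRestrict ℚ K τ = g * absGaloisRestrict ℚ K σ * g⁻¹ → χ τ = (χ σ)⁻¹)
    (a : ideleGroup K) : Λ (absGaloisQuot ℚ K g • a) = (Λ a)⁻¹ := by
  obtain ⟨γ, hγ, hΛa⟩ := idelicCharacter_exists_eq hΛ a
  rw [idelicCharacter_smul hΛ g hγ, hΛa]
  exact hg γ _ (absGaloisRestrict_absGaloisConj _ γ)

/-- **Cyclotomic sign**: if `χ` is invariant under conjugation by `g ∈ Γ_ℚ` (as is every character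
pulled back from `Γ_ℚ`), then `Λ(ḡ • a) = Λ a` (Neukirch IV (5.8) with `σ*` acting trivially).
[cite: NeukirchANT1999, Ch. IV §5 Prop. (5.8)] -/
theorem idelicCharacter_smul_eq_self [IsGalois ℚ K] (g : absoluteGaloisGroup ℚ)
    (hg : ∀ σ τ : absoluteGaloisGroup K,
      absGaloisRestrict ℚ K τ = g * absGaloisRestrict ℚ K σ * g⁻¹ → χ τ = χ σ)
    (a : ideleGroup K) : Λ (absGaloisQuot ℚ K g • a) = Λ a := by
  obtain ⟨γ, hγ, hΛa⟩ := idelicCharacter_exists_eq hΛ a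
  rw [idelicCharacter_smul hΛ g hγ, hΛa]
  exact hg γ _ (absGaloisRestrict_absGaloisConj _ γ)

end Character

/-! ### §2. The idelic character of a `ℤ_p`-extension: values through the layers -/

section Layers

variable {K : Type} [Field K] [NumberField K] {p : ℕ} [Fact p.Prime] (κ : ZpExtension K p)
  {Λ : ideleGroup K →ₜ* Multiplicative ℤ_[p]}
  (hΛ : ∀ (a : ideleGroup K) (γ : absoluteGaloisGroup K),
    absGaloisAbProj K γ = ideleArtinMap K a → Λ a = κ.toContinuousMonoidHom γ)
include hΛ

/-- **`Λ` through the layers**: if an idele `a` and `γ ∈ Γ_K` have the same image in `Gal(K_n/K)`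
for every layer `K_n` of the `ℤ_p`-extension (`ψ_{K_n|K}(a) = γ|_{K_n}`), then `Λ a = κ γ`
(`⋂ₙ Gal(K̄/K_n) = Gal(K̄/K_∞)`). [cite: Washington1997, §13.1] -/
theorem idelicCharacter_eq_of_forall_layer (a : ideleGroup K) (γ : absoluteGaloisGroup K)
    (h : ∀ (n : ℕ) [FiniteDimensional K (κ.layer n)] [IsAbelianGalois K (κ.layer n)]
      [NumberField (κ.layer n)],
      artinIdeleMap (κ.layer n) artinReciprocity_character_holds a = absRestrictNormalHom (κ.layer n) γ) :
    Λ a = κ γ := by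
  obtain ⟨γ₀, hγ₀, hΛa⟩ := idelicCharacter_exists_eq hΛ a
  rw [hΛa]
  change κ γ₀ = κ γ
  -- `γ₀⁻¹ γ` lies in every layer subgroup, hence in `ker κ`
  have hmem : γ₀⁻¹ * γ ∈ κ.kerSubgroup := by
    refine κ.mem_kerSubgroup_of_forall_mem_layerSubgroup fun n => ?_
    haveI : FiniteDimensional K (κ.layer n) := κ.finiteDimensional_layer_holds n
    haveI : IsGalois K (κ.layer n) := κ.isGalois_layer_holds n
    haveI : IsAbelianGalois K (κ.layer n) := κ.isAbelianGalois_layer n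
    haveI : NumberField (κ.layer n) := NumberField.of_module_finite K (κ.layer n)
    rw [← κ.absRestrictNormalHom_layer_eq_one_iff n, map_mul, map_inv,
      absRestrictNormalHom_eq_artinIdeleMap_of_eq (κ.layer n) hγ₀, h n, inv_mul_cancel]
  rw [mem_kerSubgroup, map_mul, map_inv, inv_mul_eq_one] at hmem
  exact hmem

/-- **`Λ(⟨𝒪_wˣ⟩) = 1` at every finite place `w ∤ p`**: the layers `K_n/K` are unramified at `w`
(Washington Prop. 13.2), so `ψ_{K_n|K}` kills the local units at `w` (Tate VII 4.2 (iii)).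
[cite: Washington1997, §13.1 Prop. 13.2] [cite: CasselsFrohlichANT1967, Ch. VII §4.2 Corollary (iii)] -/
theorem idelicCharacter_localUnits_integer {w : HeightOneSpectrum (𝓞 K)}
    (hpw : ((p : ℕ) : 𝓞 K) ∉ w.asIdeal) (u : (w.adicCompletionIntegers K)ˣ) :
    Λ (localUnits w (Units.map ((w.adicCompletionIntegers K).subtype : _ →* _) u)) = 1 := by
  rw [idelicCharacter_eq_of_forall_layer κ hΛ _ 1 fun n _ _ _ => ?_, map_one]
  rw [map_one]
  exact artinIdeleMap_localUnits_integer (κ.layer n) artinReciprocity_character_holds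
    (κ.isUnramifiedIn_layer_of_not_mem n hpw) u

/-- **The local symbol**: `Λ(⟨a_v w⟩_v) = κ(res_v w)⁻¹` for `w ∈ W_{K_v}` and THE local Artin map
`a_v` of `K_v` (local–global compatibility, Neukirch VI (5.6), on every layer).
[cite: NeukirchANT1999, Ch. VI §5 Prop. (5.6)] -/
theorem idelicCharacter_localUnits_canonicalArtin (v : HeightOneSpectrum (𝓞 K))
    (w : WeilGroup (v.adicCompletion K)) :
    Λ (localUnits v (canonicalArtin (v.adicCompletion K) w)) =
      (κ (absGaloisRestrict K (v.adicCompletion K) (WeilGroup.toAbsGalois (v.adicCompletion K) w)))⁻¹ := by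
  rw [← map_inv]
  refine idelicCharacter_eq_of_forall_layer κ hΛ _ _ fun n _ _ _ => ?_
  rw [map_inv, ArtinLocalGlobal.absRestrictNormalHom_absGaloisRestrict_toAbsGalois_eq_inv v (κ.layer n)
    (isLocalArtinMap_canonicalArtin_holds (v.adicCompletion K)) w, inv_inv]

/-- **Splitting kills the local ideles**: if the decomposition group `D_v` of the chosen prime above
`v` lies in `Gal(K̄/K_∞)` (`v` splits completely in `K_∞`), then `Λ(⟨y⟩_v) = 1` for every `y ∈ K_vˣ`
(`y = a_v w` for some `w ∈ W_{K_v}`, and `res_v w ∈ D_v ≤ ker κ`). [cite: CasselsFrohlichANT1967, Ch. VII §6 Prop. 6.2] -/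
theorem idelicCharacter_localUnits_eq_one_of_decomp_le {v : HeightOneSpectrum (𝓞 K)}
    (hv : GreenbergSelmer.decomp v ≤ κ.kerSubgroup) (y : (v.adicCompletion K)ˣ) :
    Λ (localUnits v y) = 1 := by
  obtain ⟨w, rfl⟩ := (isLocalArtinMap_canonicalArtin_holds (v.adicCompletion K)).isOpenQuotientMap_artin.surjective y
  rw [idelicCharacter_localUnits_canonicalArtin κ hΛ v w, inv_eq_one, ← mem_kerSubgroup]
  exact hv ⟨_, rfl⟩

/-- **Product formula over a finite set of places** (`K` totally complex): for a finite set `S` of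
finite places containing those above `p`, and `k ∈ Kˣ` a unit outside `S`,
`∏_{w ∈ S} Λ(⟨k⟩_w) = 1` — the principal idele of `k` (killed by `Λ`) is `(k)_∞` (killed: `K` is
totally complex) times `∏_{w ∈ S} ⟨k⟩_w` times local units away from `S` (killed: unramified).
[cite: NeukirchANT1999, Ch. VII §6 Prop. (6.13) (proof)] [cite: CasselsFrohlichANT1967, Ch. VII §4.2 Corollary (ii), (iii)] -/
theorem idelicCharacter_prod_localUnits_eq_one [IsTotallyComplex K] (S : Finset (HeightOneSpectrum (𝓞 K)))
    (hS : ∀ w : HeightOneSpectrum (𝓞 K), ((p : ℕ) : 𝓞 K) ∈ w.asIdeal → w ∈ S) (k : Kˣ)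
    (hk : ∀ w ∉ S, w.valuation K (k : K) = 1) :
    ∏ w ∈ S, Λ (localUnits w (globalToLocalUnits w k)) = 1 := by
  have h := IdelicCharacter.map_infiniteIdeles_mul_prod_localUnits_eq_one Λ
    (fun x hx => idelicCharacter_eq_one_of_mem_principalIdeles hΛ hx)
    (S := S) (fun w hw u => idelicCharacter_localUnits_integer κ hΛ (fun h => hw (hS w h)) u) k hk
  rwa [idelicCharacter_infiniteIdeles hΛ, one_mul] at h


/-! ### §3. A `ℤ_p`-extension is detected by its idelic character on the local units above `p` -/

omit hΛ in
/-- Every prime of a number field has a principal power `𝔭_w^h = (β)`, `h ≥ 1`, `β ≠ 0` (finiteness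
of the class group, Neukirch I (6.3); `h = h_K` works). [cite: NeukirchANT1999, Ch. I §6 Thm. (6.3)] -/
theorem exists_pow_asIdeal_eq_span (w : HeightOneSpectrum (𝓞 K)) :
    ∃ h : ℕ, h ≠ 0 ∧ ∃ β : 𝓞 K, β ≠ 0 ∧ w.asIdeal ^ h = Ideal.span {β} := by
  classical
  set h := Fintype.card (ClassGroup (𝓞 K)) with hh
  have hI : w.asIdeal ∈ nonZeroDivisors (Ideal (𝓞 K)) :=
    mem_nonZeroDivisors_of_ne_zero (by simpa using w.ne_bot)
  have hIh : w.asIdeal ^ h ∈ nonZeroDivisors (Ideal (𝓞 K)) := pow_mem hI h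
  have h1 : ClassGroup.mk0 ⟨w.asIdeal ^ h, hIh⟩ = 1 := by
    have : (⟨w.asIdeal ^ h, hIh⟩ : nonZeroDivisors (Ideal (𝓞 K))) = ⟨w.asIdeal, hI⟩ ^ h :=
      Subtype.ext rfl
    rw [this, map_pow, pow_card_eq_one]
  have hprinc : (w.asIdeal ^ h).IsPrincipal := (ClassGroup.mk0_eq_one_iff hIh).1 h1
  refine ⟨h, Fintype.card_ne_zero, Submodule.IsPrincipal.generator (w.asIdeal ^ h), ?_, ?_⟩
  · intro h0
    have := Ideal.span_singleton_generator (w.asIdeal ^ h)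
    rw [h0, Ideal.span_singleton_eq_bot.2 rfl] at this
    exact pow_ne_zero h w.ne_bot (this.symm.trans Ideal.zero_eq_bot.symm |>.trans rfl)
  · exact (Ideal.span_singleton_generator (w.asIdeal ^ h)).symm

omit hΛ in
/-- If `𝔭_v ^ h = (β)` then `|β|_w = 1` at every other place `w ≠ v` (unique factorisation of ideals,
Neukirch I (3.3)). [cite: NeukirchANT1999, Ch. I §3 Thm. (3.3)] -/
theorem valuation_eq_one_of_pow_asIdeal_eq_span {v w : HeightOneSpectrum (𝓞 K)} {h : ℕ} {β : 𝓞 K}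
    (hβ : v.asIdeal ^ h = Ideal.span {β}) (hwv : w ≠ v) : w.valuation K (β : K) = 1 := by
  refine le_antisymm (HeightOneSpectrum.valuation_le_one w β) (not_lt.1 fun hlt => hwv ?_)
  rw [HeightOneSpectrum.valuation_lt_one_iff_dvd, ← hβ] at hlt
  have hdvd : w.asIdeal ∣ v.asIdeal := w.prime.dvd_of_dvd_pow hlt
  have hle : v.asIdeal ≤ w.asIdeal := Ideal.le_of_dvd hdvd
  exact HeightOneSpectrum.ext (v.isMaximal.eq_of_le w.isPrime.ne_top hle).symm

omit hΛ in
/-- If `𝔭_v ^ h = (β)` (`β ≠ 0`) then `|β|_v = exp(-h)` in `K_v` (unique factorisation of ideals,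
Neukirch I (3.3), read through the `v`-adic valuation). [cite: NeukirchANT1999, Ch. I §3 Thm. (3.3)] -/
theorem valued_eq_exp_neg_of_pow_asIdeal_eq_span {v : HeightOneSpectrum (𝓞 K)} {h : ℕ} {β : 𝓞 K}
    (hβ0 : β ≠ 0) (hβ : v.asIdeal ^ h = Ideal.span {β}) :
    Valued.v (algebraMap K (v.adicCompletion K) (β : K)) = WithZero.exp (-(h : ℤ)) := by
  classical
  rw [HeckeCharacter.valued_coe_ringOfIntegers v hβ0, ← hβ, Associates.mk_pow,
    Associates.count_pow (Associates.mk_ne_zero.2 v.ne_bot) v.associates_irreducible,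
    Associates.count_self v.associates_irreducible, mul_one]

/-- **If `Λ` kills the local units above `p`, it kills every local idele `⟨y⟩_w`.**  `Λ` then kills
all local units (those away from `p` by `idelicCharacter_localUnits_integer`), so at each `w` it
factors through the valuation; and `𝔭_w^h = (β)` with the product formula gives
`Λ(⟨ϖ_w⟩)^h = Λ(⟨β⟩_w) = 1`, whence `Λ(⟨ϖ_w⟩) = 1` in the torsion-free `ℤ_p`.
[cite: NeukirchANT1999, Ch. VII §6 Prop. (6.13) (proof)] -/
theorem idelicCharacter_localUnits_eq_one_of_forall [IsTotallyComplex K]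
    (hall : ∀ (w : HeightOneSpectrum (𝓞 K)), ((p : ℕ) : 𝓞 K) ∈ w.asIdeal →
      ∀ u : (w.adicCompletionIntegers K)ˣ,
        Λ (localUnits w (Units.map ((w.adicCompletionIntegers K).subtype : _ →* _) u)) = 1)
    (w : HeightOneSpectrum (𝓞 K)) (y : (w.adicCompletion K)ˣ) : Λ (localUnits w y) = 1 := by
  classical
  have hunit : ∀ (w : HeightOneSpectrum (𝓞 K)) (u : (w.adicCompletionIntegers K)ˣ),
      Λ (localUnits w (Units.map ((w.adicCompletionIntegers K).subtype : _ →* _) u)) = 1 := by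
    intro w u
    by_cases hpw : ((p : ℕ) : 𝓞 K) ∈ w.asIdeal
    · exact hall w hpw u
    · exact idelicCharacter_localUnits_integer κ hΛ hpw u
  -- a principal power of `𝔭_w`
  obtain ⟨h, hh, β, hβ0, hβ⟩ := exists_pow_asIdeal_eq_span (K := K) w
  have hβK : (β : K) ≠ 0 := fun h0 => hβ0 (RingOfIntegers.coe_eq_zero_iff.1 h0)
  set k : Kˣ := Units.mk0 (β : K) hβK with hk
  have hkout : ∀ w' ∉ ({w} : Finset (HeightOneSpectrum (𝓞 K))), w'.valuation K (k : K) = 1 := by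
    intro w' hw'
    rw [Finset.mem_singleton] at hw'
    rw [hk, Units.val_mk0]
    exact valuation_eq_one_of_pow_asIdeal_eq_span hβ hw'
  have hprod := IdelicCharacter.map_infiniteIdeles_mul_prod_localUnits_eq_one Λ
    (fun x hx => idelicCharacter_eq_one_of_mem_principalIdeles hΛ hx)
    (S := {w}) (fun w' _ u => hunit w' u) k hkout
  rw [idelicCharacter_infiniteIdeles hΛ, one_mul, Finset.prod_singleton] at hprod
  -- `Λ(⟨β⟩_w) = Λ(⟨ϖ⟩_w)^h`
  have hβv : Valued.v ((globalToLocalUnits w k : (w.adicCompletion K)ˣ) : w.adicCompletion K) =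
      WithZero.exp (-(h : ℤ)) := by
    rw [val_globalToLocalUnits, hk, Units.val_mk0]
    exact valued_eq_exp_neg_of_pow_asIdeal_eq_span hβ0 hβ
  have hϖ := HeckeCharacter.valued_uniformizer (K := K) w
  have hpow := IdelicCharacter.map_localUnits_eq_zpow_of_valued Λ (hunit w) hϖ (globalToLocalUnits w k) hβv
  rw [hprod, zpow_natCast] at hpow
  -- torsion-freeness of `ℤ_p`
  have hϖ1 : Λ (localUnits w (HeckeCharacter.uniformizer K w)) = 1 := by
    have h1 := congrArg Multiplicative.toAdd hpow.symm
    rw [toAdd_pow, toAdd_one, nsmul_eq_mul, mul_eq_zero] at h1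
    exact Multiplicative.toAdd.injective
      ((h1.resolve_left (Nat.cast_ne_zero.mpr hh)).trans toAdd_one.symm)
  -- any `y`: `|y|_w = exp(-m)`
  have hy0 : Valued.v ((y : (w.adicCompletion K)ˣ) : w.adicCompletion K) ≠ 0 :=
    (Valuation.ne_zero_iff _).mpr y.ne_zero
  obtain ⟨m, hm⟩ : ∃ m : ℤ, Valued.v ((y : (w.adicCompletion K)ˣ) : w.adicCompletion K) =
      WithZero.exp (-m) :=
    ⟨-WithZero.log (Valued.v ((y : (w.adicCompletion K)ˣ) : w.adicCompletion K)), by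
      rw [neg_neg, WithZero.exp_log hy0]⟩
  rw [IdelicCharacter.map_localUnits_eq_zpow_of_valued Λ (hunit w) hϖ y hm, hϖ1, one_zpow]

/-- **A character killing the local units above `p`, and every local idele, is trivial**: an idele is
its infinite component (killed: `K` totally complex) times finitely many local ideles `⟨a_w⟩_w`
times a unit idele (killed: `Λ` is continuous and kills all local units,
`map_eq_one_of_forall_valued_eq_one`). [cite: CasselsFrohlichANT1967, Ch. VII §4, proof of Prop. 4.1] -/
theorem idelicCharacter_eq_one_of_forall [IsTotallyComplex K]
    (hall : ∀ (w : HeightOneSpectrum (𝓞 K)), ((p : ℕ) : 𝓞 K) ∈ w.asIdeal →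
      ∀ u : (w.adicCompletionIntegers K)ˣ,
        Λ (localUnits w (Units.map ((w.adicCompletionIntegers K).subtype : _ →* _) u)) = 1)
    (a : ideleGroup K) : Λ a = 1 := by
  classical
  have hunit : ∀ (w : HeightOneSpectrum (𝓞 K)) (u : (w.adicCompletionIntegers K)ˣ),
      Λ (localUnits w (Units.map ((w.adicCompletionIntegers K).subtype : _ →* _) u)) = 1 := by
    intro w u
    by_cases hpw : ((p : ℕ) : 𝓞 K) ∈ w.asIdeal
    · exact hall w hpw u
    · exact idelicCharacter_localUnits_integer κ hΛ hpw u
  -- strip the infinite component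
  set y : (InfiniteAdeleRing K)ˣ :=
    Units.map (MonoidHom.fst (InfiniteAdeleRing K) (FiniteAdeleRing (𝓞 K) K)) a with hy
  set c : ideleGroup K := a * (infiniteIdeles K y)⁻¹ with hc
  have hc1 : (c : AdeleRing (𝓞 K) K).1 = 1 := by
    rw [hc, ← map_inv, ideleGroup_val_fst_mul, infiniteIdeles_fst, Units.coe_map_inv]
    change (a : AdeleRing (𝓞 K) K).1 * ((a⁻¹ : ideleGroup K) : AdeleRing (𝓞 K) K).1 = 1
    rw [← ideleGroup_val_fst_mul, mul_inv_cancel]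
    rfl
  have hc2 : ∀ w, (c : AdeleRing (𝓞 K) K).2 w = (a : AdeleRing (𝓞 K) K).2 w := by
    intro w
    rw [hc, ← map_inv, ideleGroup_val_snd_mul, infiniteIdeles_snd, mul_one]
  -- the finitely many places where `c_w` is not a unit
  obtain ⟨T, hT⟩ : ∃ T : Finset (HeightOneSpectrum (𝓞 K)), ∀ w, w ∉ T →
      Valued.v ((c : AdeleRing (𝓞 K) K).2 w) = 1 := by
    have hfin := ideleGroup_valued_snd_eventually_eq_one c
    rw [Filter.eventually_cofinite] at hfin
    refine ⟨hfin.toFinset, fun w hw => ?_⟩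
    by_contra hne
    exact hw (hfin.mem_toFinset.mpr hne)
  let comp : ∀ w : HeightOneSpectrum (𝓞 K), (w.adicCompletion K)ˣ := fun w =>
    Units.mk0 ((c : AdeleRing (𝓞 K) K).2 w) (ideleGroup_snd_ne_zero c w)
  set z : ideleGroup K := c * (∏ w ∈ T, localUnits w (comp w))⁻¹ with hz
  have hz1 : (z : AdeleRing (𝓞 K) K).1 = 1 := by
    have h := ideleGroup_val_inv_fst_mul (∏ w ∈ T, localUnits w (comp w))
    rw [fst_prod_localUnits, mul_one] at h
    rw [hz, ideleGroup_val_fst_mul, hc1, one_mul, h]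
  have hz2 : ∀ w, (z : AdeleRing (𝓞 K) K).2 w =
      (c : AdeleRing (𝓞 K) K).2 w * (if w ∈ T then ((comp w : (w.adicCompletion K)ˣ) : w.adicCompletion K) else 1)⁻¹ := by
    intro w
    rw [hz, ideleGroup_val_snd_mul, ideleGroup_val_inv_snd, snd_prod_localUnits]
  have hzS : ∀ w ∈ (T : Set (HeightOneSpectrum (𝓞 K))), (z : AdeleRing (𝓞 K) K).2 w = 1 := by
    intro w hw
    have hw' : w ∈ T := hw
    rw [hz2, if_pos hw', Units.val_mk0, mul_inv_cancel₀ (ideleGroup_snd_ne_zero c w)]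
  have hzu : ∀ w, Valued.v ((z : AdeleRing (𝓞 K) K).2 w) = 1 := by
    intro w
    by_cases hw : w ∈ T
    · rw [hzS w hw, map_one]
    · rw [hz2, if_neg hw, inv_one, mul_one]
      exact hT w hw
  have hΛz : Λ z = 1 :=
    IdelicCharacter.map_eq_one_of_forall_valued_eq_one Λ (S := (T : Set (HeightOneSpectrum (𝓞 K))))
      (fun w _ u => hunit w u) z hz1 hzS hzu
  have hΛprod : Λ (∏ w ∈ T, localUnits w (comp w)) = 1 := by
    rw [map_prod]
    exact Finset.prod_eq_one fun w _ => idelicCharacter_localUnits_eq_one_of_forall κ hΛ hall w (comp w)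
  have hΛc : Λ c = 1 := by
    have h := hΛz
    rwa [hz, map_mul, map_inv, hΛprod, inv_one, mul_one] at h
  have h := hΛc
  rwa [hc, map_mul, map_inv, idelicCharacter_infiniteIdeles hΛ, inv_one, mul_one] at h

/-- **Non-vanishing on the local units above `p`.**  The idelic character of a `ℤ_p`-extension does
not kill all the local units above `p`: otherwise it would be trivial
(`idelicCharacter_eq_one_of_forall`), whereas `[·, K]` is onto `Γ_K^ab` and `κ` is onto `ℤ_p`.
(Class field theory: `K_∞/K` is a non-trivial quotient of `Gal(M/K) ∼ U_p/Ē`, Lang, *Cyclotomic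
Fields I–II*, Ch. 5 §5 Thm. 5.1.) [cite: Lang1990, Ch. 5 §5, Thm. 5.1] -/
theorem exists_idelicCharacter_localUnits_ne_one [IsTotallyComplex K] :
    ∃ (w : HeightOneSpectrum (𝓞 K)) (_ : ((p : ℕ) : 𝓞 K) ∈ w.asIdeal)
      (u : (w.adicCompletionIntegers K)ˣ),
      Λ (localUnits w (Units.map ((w.adicCompletionIntegers K).subtype : _ →* _) u)) ≠ 1 := by
  by_contra hne
  have hne' : ∀ (w : HeightOneSpectrum (𝓞 K)), ((p : ℕ) : 𝓞 K) ∈ w.asIdeal →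
      ∀ u : (w.adicCompletionIntegers K)ˣ,
        Λ (localUnits w (Units.map ((w.adicCompletionIntegers K).subtype : _ →* _) u)) = 1 := by
    intro w hw u
    by_contra h
    exact hne ⟨w, hw, u, h⟩
  obtain ⟨γ, hγ⟩ := κ.surjective (Multiplicative.ofAdd 1)
  obtain ⟨a, ha⟩ := exists_ideleArtinMap_eq (K := K) γ
  have h1 : Λ a = κ γ := hΛ a γ ha.symm
  rw [idelicCharacter_eq_one_of_forall κ hΛ hne' a] at h1
  have h2 := congrArg Multiplicative.toAdd h1
  rw [toAdd_one] at h2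
  have h3 : (κ γ).toAdd = 1 := by
    change κ γ = Multiplicative.ofAdd 1 at hγ
    rw [hγ, toAdd_ofAdd]
  exact zero_ne_one (h2.trans h3)

end Layers

end Literature.NumberTheory.EllipticCurves.ZpExtension

end
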